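import Summits.HodgeConjecture.HodgeConjecture.Theorems.F0P3cStCharTSJacCartanElliptic       -- ★ p852303 (C8b-model) (LH5-p02 g6): `exists_twistedMap`, `chart_link`, `exists_depth`, and every ★ input of the model head
import HarnessLib

/-!
# F0 · P3c · line LH6 «StCharTS» — ROAD «UP-TR» brick (H4s-E) «INTEGRAL POINT»: the local tube-Jacobian socket on `U(σ,J)(K)` at an INTEGRAL regular point of an
# ARBITRARY Cartan `T′ = Z(γ₀)` (Harish-Chandra 1970 Lemma 22; Rogawski 1990 §12.5 p. 182)

Cell `pub/hodgecm-mathlib`, crux H413 = `stmt-HodgeConjecture-24833` (lane `--supports … --as helper`); seat LH7-p02 (g8), typing hand of brick (H4s) «JAC-H-SPLIT»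
of ROAD «UP-TR» (holder F0P3-p02 (g23), dealt 2026-09-02 18:18:30Z; census (H4s) v1 18:27Z).  THEOREMS ONLY; sorry-free; no definition ∕ instance ∕ notation ∕
named fact; ★-only imports (★ C8b-model p852303 and its inputs); axioms TRIO.

THE POINT.  ★ (C8b-model) `F0P3cStCharTSJacCartanElliptic.tubeJacobianLocal_elliptic_model` proves the (E1b) tube-Jacobian socket on the model group `U(σ,J)(K)` at every
regular point of a COMPACT Cartan `T′ = Z(γ₀)`.  Its proof uses compactness at ONE place: to conjugate `T′` into the integral matrices, so that the base point `t₀` and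
its inverse are integral in the conjugated frame (`hT1`, `hTinv1` of ★ (C8b-socket) `tubeJacobianLocal_of_chartData`).  This file removes the compactness hypothesis and
asks integrality ONLY AT THE POINT: **`tubeJacobianLocal_model_of_integralPoint`** — for ANY Cartan `T′ = Z(γ₀)` (`γ₀` regular, `T′` closed), arbitrary Haar data, the
conjugation family `Φ` and a weight `D` (locally constant on the regular set, `D(t₀) = addEquivAddHaarChar L_{t₀}`), the socket holds at every regular `t₀ ∈ T′` for
which SOME `Q ∈ GL_N(K)` makes `Q t₀ Q⁻¹` and `Q t₀⁻¹ Q⁻¹` integral; and **`tubeJacobianLocal_model_of_valBound_one`** — the frame-free reading `Q = 1` (`t₀`, `t₀⁻¹`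
integral).  The proof is ★ p852303's, steps (0)–(10), with step (2) replaced by the hypothesis.
USE (ROAD «UP-TR» (H4s), census v1 §(iii)): the SPLIT Cartan `M₂ ≅ L_w^×` of `U(Φ₂)_v` is not compact, but its compact core `{|d|_w = 1}` consists of integral points
(`Q = 1`), so the socket holds there by this head; the non-compact-core points (`|d|_w ≠ 1`, eigenvalues non-units under every faithful representation) are the LEVELS
half of (H4s).  The head is generic in `N` and serves every non-compact Cartan of every `U(σ,J)(K)` at its integral points.
HONEST LABEL: count-neutral; closes no organ by itself; HC_CM is proved only modulo the 7 printed citations (2 remaining: hLiu418 = `stmt-HodgeConjecture-24832`,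
h413 = `stmt-HodgeConjecture-24833`) until rung 0 closes.

## References
* [HarishChandra1970] Harish-Chandra (notes by G. van Dijk), *Harmonic Analysis on Reductive p-adic Groups*, LNM 162 (1970), Part V §4 Lemma 22 (the Jacobian of the
  conjugation map `(x, γ) ↦ xγx⁻¹`, read locally at a regular point). Context locator.
* [Rogawski1990] J. D. Rogawski, *Automorphic Representations of Unitary Groups in Three Variables*, Ann. of Math. Stud. 123 (1990), §12.5 p. 182 (Weyl integration
  formula). Context locator.
* [PlatonovRapinchuk1994] V. Platonov, A. Rapinchuk, *Algebraic Groups and Number Theory* (1994), §3.3 (Cayley chart, congruence filtrations). Context locator.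
-/

set_option autoImplicit false
set_option linter.dupNamespace false

open Set Filter MeasureTheory MeasureTheory.Measure TopologicalSpace Topology Matrix ValuativeRel
open Literature.NumberTheory.Automorphic Literature.NumberTheory.Automorphic.UnitaryGroup Literature.NumberTheory.Weil1982.UnitaryFinTopForm
open Literature.MeasureTheory.Group
open Literature.NumberTheory.Rogawski1990 (IsRegularElt isRegularElt_iff)
open Summit.HodgeConjecture.HodgeConjecture.Cruxes.H413.F0P3cStCharTSCayleyChartHaar
open Summit.HodgeConjecture.HodgeConjecture.Cruxes.H413.F0P3cStCharTSCayleyChartUnitary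
open Summit.HodgeConjecture.HodgeConjecture.Cruxes.H413.F0P3cStCharTSCayleyChartUnitaryModel
open Summit.HodgeConjecture.HodgeConjecture.Cruxes.H413.F0P3cStCharTSTwistedTubeCore
open Summit.HodgeConjecture.HodgeConjecture.Cruxes.H413.F0P3cStCharTSJacCartanProduct
open Summit.HodgeConjecture.HodgeConjecture.Cruxes.H413.F0P3cStCharTSJacCartanSocketCore
open Summit.HodgeConjecture.HodgeConjecture.Cruxes.H413.F0P3cStCharTSJacCartanModelFrame
open Summit.HodgeConjecture.HodgeConjecture.Cruxes.H413.F0P3cStCharTSJacCartanFixedField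
open Summit.HodgeConjecture.HodgeConjecture.Cruxes.H413.F0P3cStCharTSJacCartanModelData
open Summit.HodgeConjecture.HodgeConjecture.Cruxes.H413.F0P3cStCharTSCartanDecompositionAd
open Summit.HodgeConjecture.HodgeConjecture.Cruxes.H413.F0P3cStCharTSCartanDecompositionSkew
open Summit.HodgeConjecture.HodgeConjecture.Cruxes.H413.F0P3cStCharTSLevelShift
open Summit.HodgeConjecture.HodgeConjecture.Cruxes.H413.F0P3cStCharTSJacCartanElliptic
open scoped Pointwise Topology ENNReal NNReal MatrixGroups

namespace Summit.HodgeConjecture.HodgeConjecture.Cruxes.H413.F0P3cStCharTSJacCartanIntegralPoint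

variable {K : Type*} [Field K] [ValuativeRel K] [TopologicalSpace K] [IsNonarchimedeanLocalField K] [CharZero K] [SecondCountableTopology K] [T2Space K]
  {N : ℕ} (σ : K →+* K) (J : Matrix (Fin N) (Fin N) K)

/-! ## §1 The model head at an integral point of an arbitrary Cartan -/

/-- **THE LOCAL TUBE-JACOBIAN SOCKET ON `U(σ,J)(K)` AT AN INTEGRAL REGULAR POINT OF AN ARBITRARY CARTAN `T′ = Z(γ₀)`** (`γ₀` regular, `T′` closed, NOT assumed compact):
for arbitrary Haar data `(ν, tm)`, the conjugation family `Φ` and a weight `D` locally constant on the regular set with `D(t₀) = addEquivAddHaarChar L_{t₀}`, EVERY regular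
`t₀ ∈ T′` such that `Q t₀ Q⁻¹` and `Q t₀⁻¹ Q⁻¹` are integral for some `Q ∈ GL_N(K)` has a neighbourhood `U ⊆ T′` and a Borel transversal class `A₀ ⊆ G⧸T′` of positive finite
quotient mass with `ν(Φ(A₀ × V)) = μ₀(A₀) · ∫⁻_V D dtm` for all Borel `V ⊆ U` — ★ p852303 with its single use of compactness replaced by the pointwise hypothesis.
[cite: HarishChandra1970, Lemma 22] [cite: Rogawski1990, §12.5 p. 182] [cite: PlatonovRapinchuk1994, §3.3] -/
theorem tubeJacobianLocal_model_of_integralPoint (hσ : Continuous σ) (hσ2 : ∀ a, σ (σ a) = a) (hJ : IsUnit J.det)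
    {γ₀ : ↥(unitaryGroupOfForm σ J)} (hγ₀ : IsRegularElt (γ₀ : GL (Fin N) K))
    {T' : Subgroup ↥(unitaryGroupOfForm σ J)} (hT' : ∀ g, g ∈ T' ↔ g * γ₀ = γ₀ * g)
    [MeasurableSpace ↥(unitaryGroupOfForm σ J)] [BorelSpace ↥(unitaryGroupOfForm σ J)] [LocallyCompactSpace ↥(unitaryGroupOfForm σ J)]
    [SecondCountableTopology ↥(unitaryGroupOfForm σ J)] [T2Space ↥(unitaryGroupOfForm σ J)]
    (hT'c : IsClosed (T' : Set ↥(unitaryGroupOfForm σ J)))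
    [MeasurableSpace (↥(unitaryGroupOfForm σ J) ⧸ T')] [BorelSpace (↥(unitaryGroupOfForm σ J) ⧸ T')]
    (ν : Measure ↥(unitaryGroupOfForm σ J)) [ν.IsHaarMeasure] [ν.IsMulRightInvariant]
    (tm : Measure ↥T') [tm.IsMulLeftInvariant] [IsFiniteMeasureOnCompacts tm] [tm.IsOpenPosMeasure] [tm.IsInvInvariant]
    (Φ : (↥(unitaryGroupOfForm σ J) ⧸ T') × ↥T' → ↥(unitaryGroupOfForm σ J))
    (hΦ : ∀ (x : ↥(unitaryGroupOfForm σ J)) (t : ↥T'), Φ (QuotientGroup.mk x, t) = x * t * x⁻¹)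
    (D : ↥T' → ℝ≥0) (hDlc : ∀ t₀ : ↥T', IsRegularElt ((t₀ : ↥(unitaryGroupOfForm σ J)) : GL (Fin N) K) → ∀ᶠ t in 𝓝 t₀, D t = D t₀)
    (hDval : ∀ t₀ : ↥T', IsRegularElt ((t₀ : ↥(unitaryGroupOfForm σ J)) : GL (Fin N) K) →
      ∀ (𝔲 : AddSubgroup (Matrix (Fin N) (Fin N) K)) [MeasurableSpace ↥𝔲] [BorelSpace ↥𝔲] [LocallyCompactSpace ↥𝔲],
        (∀ X, X ∈ 𝔲 ↔ (X.map σ)ᵀ * J + J * X = 0) → ∀ L : ↥𝔲 ≃ₜ+ ↥𝔲,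
          (∀ X : ↥𝔲, (X : Matrix (Fin N) (Fin N) K) * (((t₀ : ↥(unitaryGroupOfForm σ J)) : GL (Fin N) K) : Matrix (Fin N) (Fin N) K) =
              (((t₀ : ↥(unitaryGroupOfForm σ J)) : GL (Fin N) K) : Matrix (Fin N) (Fin N) K) * X → L X = X) →
          (∀ (X : ↥𝔲) (Y : Matrix (Fin N) (Fin N) K),
              (X : Matrix (Fin N) (Fin N) K) = (((t₀ : ↥(unitaryGroupOfForm σ J)) : GL (Fin N) K) : Matrix (Fin N) (Fin N) K) * Y *
                  ((((t₀ : ↥(unitaryGroupOfForm σ J)) : GL (Fin N) K)⁻¹ : GL (Fin N) K) : Matrix (Fin N) (Fin N) K) - Y →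
              ((L X : ↥𝔲) : Matrix (Fin N) (Fin N) K) = ((((t₀ : ↥(unitaryGroupOfForm σ J)) : GL (Fin N) K)⁻¹ : GL (Fin N) K) : Matrix (Fin N) (Fin N) K) * X *
                  (((t₀ : ↥(unitaryGroupOfForm σ J)) : GL (Fin N) K) : Matrix (Fin N) (Fin N) K) - X) →
          ((D t₀ : ℝ≥0) : ℝ≥0∞) = addEquivAddHaarChar L) :
    ∀ t₀ : ↥T', IsRegularElt ((t₀ : ↥(unitaryGroupOfForm σ J)) : GL (Fin N) K) →
      (∃ Q : GL (Fin N) K, ValBound 1 ((Q * (t₀ : ↥(unitaryGroupOfForm σ J)).1 * Q⁻¹ : GL (Fin N) K) : Matrix (Fin N) (Fin N) K) ∧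
        ValBound 1 ((Q * ((t₀ : ↥(unitaryGroupOfForm σ J))⁻¹).1 * Q⁻¹ : GL (Fin N) K) : Matrix (Fin N) (Fin N) K)) →
      ∃ U : Set ↥T', IsOpen U ∧ t₀ ∈ U ∧
        ∃ A₀ : Set (↥(unitaryGroupOfForm σ J) ⧸ T'), MeasurableSet A₀ ∧ quotientMeasure T' tm hT'c ν A₀ ≠ 0 ∧ quotientMeasure T' tm hT'c ν A₀ ≠ ∞ ∧
          ∀ V : Set ↥T', MeasurableSet V → V ⊆ U →
            (∀ t ∈ V, IsRegularElt ((t : ↥(unitaryGroupOfForm σ J)) : GL (Fin N) K)) →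
            (∀ n : ↥(unitaryGroupOfForm σ J), n ∉ T' → ∀ t ∈ V, ∀ t' ∈ V, ((t' : ↥T') : ↥(unitaryGroupOfForm σ J)) ≠ n * t * n⁻¹) →
              ν (Φ '' (A₀ ×ˢ V)) = quotientMeasure T' tm hT'c ν A₀ * ∫⁻ t in V, (D t : ℝ≥0∞) ∂tm := by
  intro t₀' ht₀reg hint'
  classical
  -- ### (0) names
  set t₀ : ↥(unitaryGroupOfForm σ J) := (t₀' : ↥(unitaryGroupOfForm σ J)) with ht₀def
  have ht₀ : t₀ ∈ T' := t₀'.2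
  set tG : GL (Fin N) K := t₀.1 with htGdef
  set tGm : Matrix (Fin N) (Fin N) K := (tG : Matrix (Fin N) (Fin N) K) with htGmdef
  set tGi : Matrix (Fin N) (Fin N) K := ((tG⁻¹ : GL (Fin N) K) : Matrix (Fin N) (Fin N) K) with htGidef
  set γm : Matrix (Fin N) (Fin N) K := ((γ₀.1 : GL (Fin N) K) : Matrix (Fin N) (Fin N) K) with hγmdef
  have htU : (tGm.map σ)ᵀ * J * tGm = J := mem_unitaryGroupOfForm_iff.1 t₀.2
  have hsep : tGm.charpoly.Separable := (isRegularElt_iff _).1 ht₀reg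
  have hγsep : γm.charpoly.Separable := (isRegularElt_iff _).1 hγ₀
  have htγ : Commute tGm γm := by
    have h := (hT' t₀).1 ht₀
    have h' := congrArg (fun g : ↥(unitaryGroupOfForm σ J) => ((g.1 : GL (Fin N) K) : Matrix (Fin N) (Fin N) K)) h
    simpa [Commute, SemiconjBy] using h'
  -- ### (1) scalars: the residue characteristic `q`, `α = |q| < 1`, `β = |2| α`
  obtain ⟨q, hq0, hq1⟩ := exists_natCast_valuation_lt_one K
  set α : ValueGroupWithZero K := valuation K (q : K) with hαdef
  have hα : α ≠ 0 := by rw [hαdef, Ne, map_eq_zero]; exact hq0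
  have hα1 : α < 1 := hq1
  have h2 : (2 : K) ≠ 0 := two_ne_zero
  have h2v : valuation K 2 ≠ 0 := by rw [Ne, map_eq_zero]; exact h2
  have hβ0 : valuation K 2 * α ≠ 0 := mul_ne_zero h2v hα
  have hβ : valuation K 2 * α < valuation K 2 := mul_lt_of_lt_one_right (zero_lt_iff.2 h2v) hα1
  -- ### (2) the point `t₀` (and its inverse) is conjugated into the integral matrices by `Q` (hypothesis)
  obtain ⟨Q, hQt, hQtinv⟩ := hint'
  set Qm : Matrix (Fin N) (Fin N) K := (Q : Matrix (Fin N) (Fin N) K) with hQmdef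
  set Qi : Matrix (Fin N) (Fin N) K := ((Q⁻¹ : GL (Fin N) K) : Matrix (Fin N) (Fin N) K) with hQidef
  have hQQ : Qi * Qm = 1 := by rw [hQidef, hQmdef, ← Units.val_mul, inv_mul_cancel, Units.val_one]
  set J' : Matrix (Fin N) (Fin N) K := (Qi.map σ)ᵀ * J * Qi with hJ'def
  -- ### (3) the fixed field `F = K^σ`, the Lie algebra `𝔲 = 𝔲(σ,J)` over `F`, its Borel structure and Haar measure
  obtain ⟨F, hF⟩ := exists_fixedSubfield σ
  haveI : FiniteDimensional ↥F K := finiteDimensional_of_involutive σ h2 hσ2 F hF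
  obtain ⟨𝔲, h𝔲⟩ := exists_fixedSubmodule_skew σ J F hF
  have h𝔲cl : IsClosed (𝔲 : Set (Matrix (Fin N) (Fin N) K)) := by
    have : (𝔲 : Set (Matrix (Fin N) (Fin N) K)) = {X | (X.map σ)ᵀ * J + J * X = 0} := Set.ext fun X => h𝔲 X
    rw [this]; exact isClosed_setOf_skew σ J hσ
  letI : MeasurableSpace ↥𝔲 := borel _
  haveI : BorelSpace ↥𝔲 := ⟨rfl⟩
  haveI : LocallyCompactSpace (Matrix (Fin N) (Fin N) K) := inferInstanceAs (LocallyCompactSpace (Fin N → Fin N → K))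
  haveI : LocallyCompactSpace ↥𝔲 := h𝔲cl.isClosedEmbedding_subtypeVal.locallyCompactSpace
  haveI : SecondCountableTopology (Matrix (Fin N) (Fin N) K) := inferInstanceAs (SecondCountableTopology (Fin N → Fin N → K))
  haveI : SecondCountableTopology ↥𝔲 := h𝔲cl.isClosedEmbedding_subtypeVal.isEmbedding.secondCountableTopology
  set μ : Measure ↥𝔲 := Measure.addHaar with hμdef
  -- ### (4) the conjugated frame (★ C8b-data) and ★ (C4u)
  obtain ⟨ι, ρ, hιapp, hρapp, hι, hρ, hρinj, hιr, hρr⟩ := exists_conjFrame σ J hσ Q 𝔲 h𝔲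
  obtain ⟨Λ, c, σV, hΛ, hc, hσV, hσVc, hwin, -, hchart'⟩ := exists_cayley_chart_haar σ J' 1 ι ρ μ ν hι hρ hρinj hιr hρr hα hα1 hβ0 hβ le_rfl
  have hanti := level_antitone ι Λ hΛ hα1.le
  have hcc : ContinuousOn c (Λ 0 : Set ↥𝔲) := continuousOn_chart ι Λ ρ c hι.continuous hΛ hα1 hρ hc
  have hK0 : IsOpen (c '' (Λ 0 : Set ↥𝔲)) := isOpen_image_chart ι Λ ρ c σV hι hΛ hα hα1 hρ hρinj hc hσV hσVc hβ0 hwin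
  have hcomp0 : IsCompact (Λ 0 : Set ↥𝔲) := isCompact_level ι Λ hι hΛ 0
  have hopenΛ := isOpen_level ι Λ hι.continuous hΛ hα
  have h0c : c 0 = 1 := chart_zero ι Λ ρ c hρinj hc
  set κ : ℝ≥0∞ := μ (Λ 0 : Set ↥𝔲) / ν (c '' (Λ 0 : Set ↥𝔲)) with hκdef
  have hμ0 : μ (Λ 0 : Set ↥𝔲) ≠ 0 := (hopenΛ 0).measure_ne_zero μ ⟨0, zero_mem _⟩
  have hμt : μ (Λ 0 : Set ↥𝔲) ≠ ∞ := hcomp0.measure_lt_top.ne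
  have hν0 : ν (c '' (Λ 0 : Set ↥𝔲)) ≠ 0 := hK0.measure_ne_zero ν ⟨1, ⟨0, zero_mem _, h0c⟩⟩
  have hνt : ν (c '' (Λ 0 : Set ↥𝔲)) ≠ ∞ := (hcomp0.image_of_continuousOn hcc).measure_lt_top.ne
  have hκ0 : κ ≠ 0 := ENNReal.div_ne_zero.2 ⟨hμ0, hνt⟩
  have hκt : κ ≠ ∞ := ENNReal.div_ne_top hμt hν0
  have hchart : ∀ B ⊆ (Λ 0 : Set ↥𝔲), MeasurableSet (c '' B) → κ * ν (c '' B) = μ B := fun B hB hBm => (hchart' B hB hBm).symm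
  -- ### (5) the Cartan data at `t₀` (★ C8b-data over `K^σ`)
  obtain ⟨pM, pT, L, hsum, hidem, hpMc, hpTc, hpTcomm, hkerpM, hLform, hLfix, hL𝔪', hpMs', hpTs', hLss'⟩ :=
    exists_cartanData σ J 𝔲 h𝔲 hJ tG htU hsep
  set Tm : Matrix (Fin N) (Fin N) K := ((ρ t₀ : GL (Fin N) K) : Matrix (Fin N) (Fin N) K) with hTmdef0
  set Ti : Matrix (Fin N) (Fin N) K := (((ρ t₀)⁻¹ : GL (Fin N) K) : Matrix (Fin N) (Fin N) K) with hTidef0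
  have hTm : Tm = Qm * tGm * Qi := by rw [hTmdef0, hρapp, Units.val_mul, Units.val_mul]
  have hTinv : Ti = Qm * tGi * Qi := by
    rw [hTidef0, hρapp, show (Q * tG * Q⁻¹)⁻¹ = Q * tG⁻¹ * Q⁻¹ by group, Units.val_mul, Units.val_mul]
  have hT1 : ValBound 1 Tm := by rw [hTmdef0, hρapp]; exact hQt
  have hTinv1 : ValBound 1 Ti := by rw [hTidef0, ← map_inv, hρapp]; exact hQtinv
  have hL : ∀ Z, ι (L Z) = Ti * ι (pM Z) * Tm - ι (pM Z) + ι (pT Z) := by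
    intro Z
    rw [hιapp, hLform, hιapp, hιapp, hTm, hTinv]
    calc Qm * (tGi * (pM Z).1 * tGm - (pM Z).1 + (pT Z).1) * Qi
        = Qm * tGi * 1 * (pM Z).1 * 1 * tGm * Qi - Qm * (pM Z).1 * Qi + Qm * (pT Z).1 * Qi := by noncomm_ring
      _ = _ := by rw [← hQQ]; noncomm_ring
  -- ### (6) the chart link
  obtain ⟨hcT, hTc⟩ := chart_link σ J ι ρ Q hιapp hρapp hρinj hρr Λ hΛ hα1 h2 c hc pM pT hsum tG hpTcomm hkerpM hsep hγsep htγ hT'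
  -- ### (7) uniform level shifts (★ Q11, scaling by `q ∈ K^σ`), the local-constancy window of `D`, the base depth `k`, the sub-box
  have hqF : σ (q : K) = q := map_natCast σ q
  set qF : ↥F := ⟨(q : K), (hF _).2 hqF⟩ with hqFdef
  have hqF0 : qF ≠ 0 := fun h => hq0 (congrArg Subtype.val h)
  let s : ↥𝔲 ≃+ ↥𝔲 := (LinearEquiv.smulOfUnit (Units.mk0 qF hqF0) : ↥𝔲 ≃ₗ[↥F] ↥𝔲).toAddEquiv
  have hsapp : ∀ Z : ↥𝔲, s Z = qF • Z := fun Z => by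
    show (Units.mk0 qF hqF0 : (↥F)ˣ) • Z = qF • Z
    rw [Units.smul_mk0]
  have hsι : ∀ Z, ι (s Z) = (q : K) • ι Z := fun Z => by
    rw [hsapp, hιapp, hιapp, Submodule.coe_smul, Subfield.smul_def, Matrix.mul_smul, Matrix.smul_mul]
  obtain ⟨k, hshift, hshiftL, hD⟩ := exists_depth ι Λ hι hΛ hα hα1 s hsι hαdef.symm pM pT L hpMc hpTc
    (fun Z => by rw [hsapp, hsapp, hpMs']) (fun Z => by rw [hsapp, hsapp, hpTs']) (fun Z => by rw [hsapp, hsapp, hLss']) c hcc h0c hopenΛ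
    t₀' D (hDlc t₀' ht₀reg)
  obtain ⟨Λ', hΛ'⟩ := exists_subBox Λ pM pT
  -- ### (8) the product map `Ξ` and the tube map `Θ`
  let Ξ : ↥𝔲 → ↥𝔲 := fun Z => σV (pM Z) (pT Z)
  have hΞ : ∀ Z ∈ Λ' k, ι (Ξ Z) = (1 - ι (pM Z))⁻¹ * (ι (pM Z) + ι (pT Z)) * (1 + ι (pM Z) * ι (pT Z))⁻¹ * (1 - ι (pM Z)) := fun Z hZ => by
    obtain ⟨hM, hT⟩ := (hΛ' k Z).1 hZ
    exact hσV _ (hanti (Nat.zero_le k) hM) _ (hanti (Nat.zero_le k) hT)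
  have hskewι : ∀ Z : ↥𝔲, ((ι Z).map σ)ᵀ * J' + J' * ι Z = 0 := fun Z => ((hιr (ι Z)).1 ⟨Z, rfl⟩).1
  have hTunit : (Ti.map σ)ᵀ * J' * Ti = J' := ((hρr _).1 ⟨t₀⁻¹, by rw [map_inv]⟩).1
  obtain ⟨Θ, hΘ⟩ := exists_twistedMap σ ι Λ Λ' pM pT (k := k) hΛ hα1 h2 hΛ' hskewι (fun X hX => (hιr X).2 ⟨hX, by rw [mul_one, one_mul]⟩)
    (ρ t₀)⁻¹ hTunit hTinv1 (by rw [inv_inv]; exact hT1)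
  simp only [inv_inv] at hΘ
  -- ### (9) the value of the weight at `t₀`
  have hDχ : ((D ⟨t₀, ht₀⟩ : ℝ≥0) : ℝ≥0∞) = addEquivAddHaarChar L :=
    @hDval t₀' ht₀reg 𝔲.toAddSubgroup (borel ↥𝔲) ⟨rfl⟩ ‹LocallyCompactSpace ↥𝔲› (fun X => h𝔲 X) L hLfix hL𝔪'
  -- ### (10) ★ (C8b-socket)
  haveI : SigmaCompactSpace ↥T' := hT'c.isClosedEmbedding_subtypeVal.sigmaCompactSpace
  haveI : SFinite tm := inferInstance
  obtain ⟨U, hUo, hU0, A₀, hA₀m, hA0, hAt, hV⟩ := tubeJacobianLocal_of_chartData ι Λ ρ c σV pM pT L Θ Ξ T' μ ν tm hT'c hι hΛ hα hα1 h2 hρinj hc hcc hK0 hσV hσVc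
    hΛ' hsum hidem hpMc hpTc hshift hΞ hcT hTc ht₀ hT1 hTinv1 hL hΘ hshiftL hκ0 hκt hchart Φ hΦ D hD hDχ
  exact ⟨U, hUo, hU0, A₀, hA₀m, hA0, hAt, fun V hVm hVU _ _ => hV V hVm hVU⟩

/-! ## §2 The frame-free reading (`Q = 1`) -/

/-- **THE SOCKET AT A POINT THAT IS ITSELF INTEGRAL** (`Q = 1`): if `t₀` and `t₀⁻¹` are integral matrices, the local tube-Jacobian socket holds at `t₀` on any Cartan
`T′ = Z(γ₀)` through it — the case of the compact core `{|d|_w = 1}` of a split torus. [cite: HarishChandra1970, Lemma 22] [cite: Rogawski1990, §12.5 p. 182] -/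
theorem tubeJacobianLocal_model_of_valBound_one (hσ : Continuous σ) (hσ2 : ∀ a, σ (σ a) = a) (hJ : IsUnit J.det)
    {γ₀ : ↥(unitaryGroupOfForm σ J)} (hγ₀ : IsRegularElt (γ₀ : GL (Fin N) K))
    {T' : Subgroup ↥(unitaryGroupOfForm σ J)} (hT' : ∀ g, g ∈ T' ↔ g * γ₀ = γ₀ * g)
    [MeasurableSpace ↥(unitaryGroupOfForm σ J)] [BorelSpace ↥(unitaryGroupOfForm σ J)] [LocallyCompactSpace ↥(unitaryGroupOfForm σ J)]
    [SecondCountableTopology ↥(unitaryGroupOfForm σ J)] [T2Space ↥(unitaryGroupOfForm σ J)]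
    (hT'c : IsClosed (T' : Set ↥(unitaryGroupOfForm σ J)))
    [MeasurableSpace (↥(unitaryGroupOfForm σ J) ⧸ T')] [BorelSpace (↥(unitaryGroupOfForm σ J) ⧸ T')]
    (ν : Measure ↥(unitaryGroupOfForm σ J)) [ν.IsHaarMeasure] [ν.IsMulRightInvariant]
    (tm : Measure ↥T') [tm.IsMulLeftInvariant] [IsFiniteMeasureOnCompacts tm] [tm.IsOpenPosMeasure] [tm.IsInvInvariant]
    (Φ : (↥(unitaryGroupOfForm σ J) ⧸ T') × ↥T' → ↥(unitaryGroupOfForm σ J))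
    (hΦ : ∀ (x : ↥(unitaryGroupOfForm σ J)) (t : ↥T'), Φ (QuotientGroup.mk x, t) = x * t * x⁻¹)
    (D : ↥T' → ℝ≥0) (hDlc : ∀ t₀ : ↥T', IsRegularElt ((t₀ : ↥(unitaryGroupOfForm σ J)) : GL (Fin N) K) → ∀ᶠ t in 𝓝 t₀, D t = D t₀)
    (hDval : ∀ t₀ : ↥T', IsRegularElt ((t₀ : ↥(unitaryGroupOfForm σ J)) : GL (Fin N) K) →
      ∀ (𝔲 : AddSubgroup (Matrix (Fin N) (Fin N) K)) [MeasurableSpace ↥𝔲] [BorelSpace ↥𝔲] [LocallyCompactSpace ↥𝔲],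
        (∀ X, X ∈ 𝔲 ↔ (X.map σ)ᵀ * J + J * X = 0) → ∀ L : ↥𝔲 ≃ₜ+ ↥𝔲,
          (∀ X : ↥𝔲, (X : Matrix (Fin N) (Fin N) K) * (((t₀ : ↥(unitaryGroupOfForm σ J)) : GL (Fin N) K) : Matrix (Fin N) (Fin N) K) =
              (((t₀ : ↥(unitaryGroupOfForm σ J)) : GL (Fin N) K) : Matrix (Fin N) (Fin N) K) * X → L X = X) →
          (∀ (X : ↥𝔲) (Y : Matrix (Fin N) (Fin N) K),
              (X : Matrix (Fin N) (Fin N) K) = (((t₀ : ↥(unitaryGroupOfForm σ J)) : GL (Fin N) K) : Matrix (Fin N) (Fin N) K) * Y *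
                  ((((t₀ : ↥(unitaryGroupOfForm σ J)) : GL (Fin N) K)⁻¹ : GL (Fin N) K) : Matrix (Fin N) (Fin N) K) - Y →
              ((L X : ↥𝔲) : Matrix (Fin N) (Fin N) K) = ((((t₀ : ↥(unitaryGroupOfForm σ J)) : GL (Fin N) K)⁻¹ : GL (Fin N) K) : Matrix (Fin N) (Fin N) K) * X *
                  (((t₀ : ↥(unitaryGroupOfForm σ J)) : GL (Fin N) K) : Matrix (Fin N) (Fin N) K) - X) →
          ((D t₀ : ℝ≥0) : ℝ≥0∞) = addEquivAddHaarChar L) :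
    ∀ t₀ : ↥T', IsRegularElt ((t₀ : ↥(unitaryGroupOfForm σ J)) : GL (Fin N) K) →
      ValBound 1 (((t₀ : ↥(unitaryGroupOfForm σ J)).1 : GL (Fin N) K) : Matrix (Fin N) (Fin N) K) →
      ValBound 1 ((((t₀ : ↥(unitaryGroupOfForm σ J))⁻¹).1 : GL (Fin N) K) : Matrix (Fin N) (Fin N) K) →
      ∃ U : Set ↥T', IsOpen U ∧ t₀ ∈ U ∧
        ∃ A₀ : Set (↥(unitaryGroupOfForm σ J) ⧸ T'), MeasurableSet A₀ ∧ quotientMeasure T' tm hT'c ν A₀ ≠ 0 ∧ quotientMeasure T' tm hT'c ν A₀ ≠ ∞ ∧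
          ∀ V : Set ↥T', MeasurableSet V → V ⊆ U →
            (∀ t ∈ V, IsRegularElt ((t : ↥(unitaryGroupOfForm σ J)) : GL (Fin N) K)) →
            (∀ n : ↥(unitaryGroupOfForm σ J), n ∉ T' → ∀ t ∈ V, ∀ t' ∈ V, ((t' : ↥T') : ↥(unitaryGroupOfForm σ J)) ≠ n * t * n⁻¹) →
              ν (Φ '' (A₀ ×ˢ V)) = quotientMeasure T' tm hT'c ν A₀ * ∫⁻ t in V, (D t : ℝ≥0∞) ∂tm := by
  intro t₀ ht₀reg h1 h2
  refine tubeJacobianLocal_model_of_integralPoint σ J hσ hσ2 hJ hγ₀ hT' hT'c ν tm Φ hΦ D hDlc hDval t₀ ht₀reg ⟨1, ?_, ?_⟩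
  · simpa only [one_mul, inv_one, mul_one] using h1
  · simpa only [one_mul, inv_one, mul_one] using h2

end Summit.HodgeConjecture.HodgeConjecture.Cruxes.H413.F0P3cStCharTSJacCartanIntegralPoint
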